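import Summits.Ventures.LatticeQCDFlow.Scoring.TorusCovarianceDecay2D
import HarnessLib

/-!
# The exact non-abelian area law in two dimensions, V-s: EXPONENTIAL CLUSTERING AT EVERY COUPLING — the Osterwalder–Seiler clustering shape in `d = 2` with no restriction on `β`

HONEST FRAMING: exact (Metropolis-corrected) sampling algorithms for lattice gauge theory;
figures of merit are autocorrelation/cost numbers at stated couplings and volumes; no
continuum-physics claim.

Venture `LatticeQCDFlow` (cell pub-lqcd), sub-topic `Scoring`; FANOUT row 5 (`s0-sun-a`), GEN-22.
NEW WORK of the cell (placement rule).  Setting of `Literature…QuantumLattice.LatticeGaugeDLR` (configurations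
`LGConfig 2 G` on the edges of `ℤ²`, cylinder observables, translations `configShift x`, the periodic transport
`toTorusObservable (L+1) F`, theory-2's torus Wilson states `wilsonExpectation ρ β` on `(ℤ/(L+1))²`); every
compact second-countable gauge group `G`, every continuous representation `ρ`, EVERY real `β`.

* **`torusClustering_two`** — for bounded continuous cylinder observables `F₁`, `F₂` (supports over boxes),
  every real `β` and EVERY `m > 0` there is `C` with, for every lattice vector `x ∈ ℤ²` and all sufficiently
  large `L`,
  `|⟨F₁ · (F₂ ∘ θ_x)⟩_{L+1,β} − ⟨F₁⟩_{L+1,β} ⟨F₂ ∘ θ_x⟩_{L+1,β}| ≤ C e^{−m‖x‖}`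
  — the shape of the Osterwalder–Seiler core fact `osterwalder_seiler_torusClustering` (there: `0 ≤ β < β₀`,
  some mass `m(β) > 0`, by the convergent cluster expansion, every `d ≥ 2`) in `d = 2` WITH NO RESTRICTION ON
  THE COUPLING AND WITH ARBITRARILY LARGE MASS.  Mechanism (parts VIII, VIII-b, V-r): once `‖x‖_∞` exceeds the
  sizes of the supports the two observables sit in disjoint column or row bands, where their torus covariance
  is exponentially small in the VOLUME (`TorusCovarianceDecay2D`); the finitely many small `x` are absorbed in
  `C` by the trivial bound `2 C₁ C₂`.
* **`torusClustering_two_of_isLocalObservable`** — the same for `IsLocalObservable F₁`, `IsLocalObservable F₂`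
  (every finite edge set sits over a box).
(Companion of part V-q `InfiniteVolumeAnalytic2D` — the `…torusLocalLimit` shape at every coupling; the two
together are the two-dimensional, all-coupling form of Osterwalder–Seiler 1978 Thms. 3.5–3.7.)

No `def`, nothing cited as a fact, 0 sorry.
-/

noncomputable section

open MeasureTheory Function Finset Filter Topology
open Literature.MathematicalPhysics.QuantumFieldTheory
open Literature.MathematicalPhysics.QuantumLattice
open Summit.Ventures.LatticeQCDFlow.Theory2.Lattice
open Summit.Ventures.LatticeQCDFlow.Theory2.Lattice.TwoDim

namespace Summit.Ventures.LatticeQCDFlow.Scoring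

variable {G : Type*} [Group G] [TopologicalSpace G] [IsTopologicalGroup G]
  [CompactSpace G] [SecondCountableTopology G] [MeasurableSpace G] [BorelSpace G] {N : ℕ}
  (ρ : G →* Matrix (Fin N) (Fin N) ℂ)

/-! ## §3. The clustering theorem at every coupling -/

section Clustering

omit [SecondCountableTopology G] in
/-- Torus expectations of a bounded observable are bounded. -/
theorem abs_wilsonExpectation_le_of_forall_abs_le {L : ℕ} [NeZero L] (hρ : Continuous ρ) (β : ℝ)
    {Φ : GaugeConfig 2 L G → ℝ} {A : ℝ} (hA : ∀ U, |Φ U| ≤ A) : |wilsonExpectation ρ β Φ| ≤ A := by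
  haveI := isProbabilityMeasure_wilsonMeasure (d := 2) (L := L) ρ hρ β
  refine (abs_wilsonExpectation_le ρ β Φ).trans ?_
  calc wilsonExpectation ρ β (fun U => |Φ U|) ≤ ∫ _U, A ∂(wilsonMeasure ρ β) :=
        integral_mono_of_nonneg (Filter.Eventually.of_forall fun U => abs_nonneg _) (integrable_const A)
          (Filter.Eventually.of_forall hA)
    _ = A := by simp

/-- **EXPONENTIAL CLUSTERING OF TWO-DIMENSIONAL LATTICE YANG–MILLS AT EVERY COUPLING** (the shape of the
Osterwalder–Seiler core fact `osterwalder_seiler_torusClustering`, in `d = 2`, with no restriction on `β` and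
every mass).  `G` compact second-countable, `ρ` continuous, `β` real, `m > 0`; `F₁`, `F₂` bounded continuous
cylinder observables of `G^{edges(ℤ²)}` whose supports sit over boxes.  Then there is `C` such that for every
`x ∈ ℤ²`, for all sufficiently large `L`,
`|⟨F₁ · (F₂ ∘ θ_x)⟩_{(ℤ/(L+1))²,β} − ⟨F₁⟩_{(ℤ/(L+1))²,β} ⟨F₂ ∘ θ_x⟩_{(ℤ/(L+1))²,β}| ≤ C e^{−m‖x‖}`. -/
theorem torusClustering_two (hρ : Continuous ρ) (β : ℝ) {m : ℝ} (hm : 0 < m) {F₁ F₂ : LGConfig 2 G → ℝ}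
    {S₁ S₂ : Finset ((Literature.MathematicalPhysics.QuantumLattice.ZdEdge 2))} (hF₁ : IsCylinder F₁ S₁)
    (hF₂ : IsCylinder F₂ S₂) (hc₁ : Continuous F₁) (hc₂ : Continuous F₂) {C₁ C₂ : ℝ}
    (hb₁ : ∀ U, |F₁ U| ≤ C₁) (hb₂ : ∀ U, |F₂ U| ≤ C₂) {a₁ b₁ a₂ b₂ : ℤ} {R₁ T₁ R₂ T₂ : ℕ}
    (hS₁ : ∀ s ∈ S₁, s.1 ∈ (range R₁ ×ˢ range T₁).image
      (fun q : ℕ × ℕ => (![a₁ + q.1, b₁ + q.2] : (Literature.Probability.LatticeModels.Site 2))))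
    (hS₂ : ∀ s ∈ S₂, s.1 ∈ (range R₂ ×ˢ range T₂).image
      (fun q : ℕ × ℕ => (![a₂ + q.1, b₂ + q.2] : (Literature.Probability.LatticeModels.Site 2)))) :
    ∃ C : ℝ, ∀ x : (Literature.Probability.LatticeModels.Site 2), ∀ᶠ L : ℕ in atTop,
      |wilsonExpectation (L := L + 1) ρ β
            (toTorusObservable (L + 1) fun U => F₁ U * F₂ (configShift x U)) -
          wilsonExpectation (L := L + 1) ρ β (toTorusObservable (L + 1) F₁) *
            wilsonExpectation (L := L + 1) ρ β (toTorusObservable (L + 1) (F₂ ∘ configShift x))| ≤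
        C * Real.exp (-m * ‖x‖) := by
  have hC₁0 : 0 ≤ C₁ := (abs_nonneg _).trans (hb₁ fun _ => 1)
  have hC₂0 : 0 ≤ C₂ := (abs_nonneg _).trans (hb₂ fun _ => 1)
  set K₀ : ℝ := max ((|a₁ - a₂| + R₁ + R₂ + 1 : ℤ) : ℝ) ((|b₁ - b₂| + T₁ + T₂ + 1 : ℤ) : ℝ) with hK₀
  have hK₀0 : 0 ≤ K₀ := le_max_of_le_left (by positivity)
  refine ⟨max 1 (2 * C₁ * C₂ * Real.exp (m * K₀)), fun x => ?_⟩
  have hCge1 : (1 : ℝ) ≤ max 1 (2 * C₁ * C₂ * Real.exp (m * K₀)) := le_max_left _ _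
  -- the shifted observable
  have hF₂x := IsCylinder.comp_configShift hF₂ x
  have hshift : Continuous (configShift (G := G) x) :=
    continuous_pi fun e => by
      simp only [configShift_apply]
      exact continuous_apply _
  have hc₂x : Continuous (F₂ ∘ configShift x) := hc₂.comp hshift
  have hb₂x : ∀ U, |(F₂ ∘ configShift x) U| ≤ C₂ := fun U => hb₂ _
  have hS₂x := sites_image_shift_sub hS₂ x
  have hprod : ∀ L : ℕ, (toTorusObservable (L + 1) fun U => F₁ U * F₂ (configShift x U)) =
      fun U => toTorusObservable (L + 1) F₁ U * toTorusObservable (L + 1) (F₂ ∘ configShift x) U :=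
    fun L => rfl
  have hsmall : Real.exp (-m * ‖x‖) ≤ max 1 (2 * C₁ * C₂ * Real.exp (m * K₀)) * Real.exp (-m * ‖x‖) :=
    le_mul_of_one_le_left (Real.exp_pos _).le hCge1
  simp_rw [hprod]
  -- separated in one of the four directions: the covariance even tends to zero
  by_cases hA : a₁ + R₁ + 1 ≤ a₂ - x 0
  · exact (eventually_abs_cov_le_of_col_sep ρ hρ β hF₁ hF₂x hc₁ hc₂x hb₁ hb₂x hS₁ hS₂x hA
      (Real.exp_pos (-m * ‖x‖))).mono fun L hL => hL.trans hsmall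
  by_cases hB : a₂ - x 0 + R₂ + 1 ≤ a₁
  · refine (eventually_abs_cov_le_of_col_sep ρ hρ β hF₂x hF₁ hc₂x hc₁ hb₂x hb₁ hS₂x hS₁ hB
      (Real.exp_pos (-m * ‖x‖))).mono fun L hL => ?_
    rw [show (fun U => toTorusObservable (L + 1) F₁ U * toTorusObservable (L + 1) (F₂ ∘ configShift x) U) =
        fun U => toTorusObservable (L + 1) (F₂ ∘ configShift x) U * toTorusObservable (L + 1) F₁ U from
        funext fun U => mul_comm _ _,
      mul_comm (wilsonExpectation _ _ (toTorusObservable (L + 1) F₁))]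
    exact hL.trans hsmall
  by_cases hC : b₁ + T₁ + 1 ≤ b₂ - x 1
  · exact (eventually_abs_cov_le_of_row_sep ρ hρ β hF₁ hF₂x hc₁ hc₂x hb₁ hb₂x hS₁ hS₂x hC
      (Real.exp_pos (-m * ‖x‖))).mono fun L hL => hL.trans hsmall
  by_cases hD : b₂ - x 1 + T₂ + 1 ≤ b₁
  · refine (eventually_abs_cov_le_of_row_sep ρ hρ β hF₂x hF₁ hc₂x hc₁ hb₂x hb₁ hS₂x hS₁ hD
      (Real.exp_pos (-m * ‖x‖))).mono fun L hL => ?_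
    rw [show (fun U => toTorusObservable (L + 1) F₁ U * toTorusObservable (L + 1) (F₂ ∘ configShift x) U) =
        fun U => toTorusObservable (L + 1) (F₂ ∘ configShift x) U * toTorusObservable (L + 1) F₁ U from
        funext fun U => mul_comm _ _,
      mul_comm (wilsonExpectation _ _ (toTorusObservable (L + 1) F₁))]
    exact hL.trans hsmall
  -- otherwise `x` is small and the constant absorbs the trivial bound `2 C₁ C₂`
  push Not at hA hB hC hD
  have hx0 : |x 0| ≤ |a₁ - a₂| + R₁ + R₂ + 1 := by
    rcases abs_cases (a₁ - a₂) with ⟨h1, _⟩ | ⟨h1, _⟩ <;> rw [h1, abs_le] <;> constructor <;> omega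
  have hx1 : |x 1| ≤ |b₁ - b₂| + T₁ + T₂ + 1 := by
    rcases abs_cases (b₁ - b₂) with ⟨h1, _⟩ | ⟨h1, _⟩ <;> rw [h1, abs_le] <;> constructor <;> omega
  have hnorm : ‖x‖ ≤ K₀ := by
    refine (pi_norm_le_iff_of_nonneg hK₀0).mpr fun i => ?_
    rw [Int.norm_eq_abs, ← Int.cast_abs]
    have h01 : ∀ k : Fin 2, k = 0 ∨ k = 1 := by decide
    rcases h01 i with rfl | rfl
    · exact (Int.cast_le.mpr hx0).trans (by rw [hK₀]; exact_mod_cast le_max_left _ _)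
    · exact (Int.cast_le.mpr hx1).trans (by rw [hK₀]; exact_mod_cast le_max_right _ _)
  refine Filter.Eventually.of_forall fun L => ?_
  have e12 : |wilsonExpectation (L := L + 1) ρ β
      (fun U => toTorusObservable (L + 1) F₁ U * toTorusObservable (L + 1) (F₂ ∘ configShift x) U)| ≤
      C₁ * C₂ :=
    abs_wilsonExpectation_le_of_forall_abs_le ρ hρ β fun U => by
      rw [abs_mul]
      exact mul_le_mul (hb₁ _) (hb₂x _) (abs_nonneg _) hC₁0
  have e1 : |wilsonExpectation (L := L + 1) ρ β (toTorusObservable (L + 1) F₁)| ≤ C₁ :=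
    abs_wilsonExpectation_le_of_forall_abs_le ρ hρ β fun U => hb₁ _
  have e2 : |wilsonExpectation (L := L + 1) ρ β (toTorusObservable (L + 1) (F₂ ∘ configShift x))| ≤ C₂ :=
    abs_wilsonExpectation_le_of_forall_abs_le ρ hρ β fun U => hb₂x _
  have hexp1 : 1 ≤ Real.exp (m * K₀) * Real.exp (-m * ‖x‖) := by
    rw [← Real.exp_add]
    exact Real.one_le_exp (by nlinarith [norm_nonneg x])
  have htot : |wilsonExpectation (L := L + 1) ρ β
            (fun U => toTorusObservable (L + 1) F₁ U * toTorusObservable (L + 1) (F₂ ∘ configShift x) U) -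
          wilsonExpectation (L := L + 1) ρ β (toTorusObservable (L + 1) F₁) *
            wilsonExpectation (L := L + 1) ρ β (toTorusObservable (L + 1) (F₂ ∘ configShift x))| ≤
      C₁ * C₂ + C₁ * C₂ := by
    refine (abs_sub _ _).trans (add_le_add e12 ?_)
    rw [abs_mul]
    exact mul_le_mul e1 e2 (abs_nonneg _) hC₁0
  refine htot.trans ?_
  calc C₁ * C₂ + C₁ * C₂ = 2 * C₁ * C₂ * 1 := by ring
    _ ≤ 2 * C₁ * C₂ * (Real.exp (m * K₀) * Real.exp (-m * ‖x‖)) :=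
      mul_le_mul_of_nonneg_left hexp1 (by positivity)
    _ = 2 * C₁ * C₂ * Real.exp (m * K₀) * Real.exp (-m * ‖x‖) := by ring
    _ ≤ max 1 (2 * C₁ * C₂ * Real.exp (m * K₀)) * Real.exp (-m * ‖x‖) :=
      mul_le_mul_of_nonneg_right (le_max_right _ _) (Real.exp_pos _).le

/-- Every finite edge set of `ℤ²` sits over a box. -/
theorem exists_zbox_of_finset (S : Finset ((Literature.MathematicalPhysics.QuantumLattice.ZdEdge 2))) :
    ∃ (a b : ℤ) (R T : ℕ), ∀ s ∈ S, s.1 ∈ (range R ×ˢ range T).image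
      (fun q : ℕ × ℕ => (![a + q.1, b + q.2] : (Literature.Probability.LatticeModels.Site 2))) := by
  classical
  set M : ℕ := S.sup fun s => Finset.univ.sup fun i : Fin 2 => (s.1 i).natAbs with hM
  have hMle : ∀ s ∈ S, ∀ i, |s.1 i| ≤ (M : ℤ) := fun s hs i => by
    rw [Int.abs_eq_natAbs, Int.ofNat_le]
    exact (Finset.le_sup (f := fun i : Fin 2 => (s.1 i).natAbs) (Finset.mem_univ i)).trans
      (Finset.le_sup (f := fun s : (Literature.MathematicalPhysics.QuantumLattice.ZdEdge 2) =>
        Finset.univ.sup fun i : Fin 2 => (s.1 i).natAbs) hs)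
  refine ⟨-(M : ℤ), -(M : ℤ), 2 * M + 1, 2 * M + 1, fun s hs => ?_⟩
  have h0 := abs_le.1 (hMle s hs 0)
  have h1 := abs_le.1 (hMle s hs 1)
  refine Finset.mem_image.2 ⟨((s.1 0 + M).toNat, (s.1 1 + M).toNat),
    Finset.mem_product.2 ⟨Finset.mem_range.2 (by omega), Finset.mem_range.2 (by omega)⟩, ?_⟩
  funext k
  have h01 : ∀ k : Fin 2, k = 0 ∨ k = 1 := by decide
  rcases h01 k with rfl | rfl
  · simp only [Matrix.cons_val_zero]
    omega
  · simp only [Matrix.cons_val_one, Matrix.cons_val_fin_one]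
    omega

/-- **THE OSTERWALDER–SEILER CLUSTERING SHAPE IN TWO DIMENSIONS, EVERY COUPLING, EVERY MASS** — stated for
`IsLocalObservable` bounded continuous observables exactly as in
`Literature…LatticeGauge.osterwalder_seiler_torusClustering` (whose coupling range is `0 ≤ β < β₀` and whose
mass is some `m(β) > 0`): here `β` is any real number and `m` any positive number. -/
theorem torusClustering_two_of_isLocalObservable (hρ : Continuous ρ) (β : ℝ) {m : ℝ} (hm : 0 < m)
    {F₁ F₂ : LGConfig 2 G → ℝ} (hF₁ : Literature.MathematicalPhysics.QuantumLattice.IsLocalObservable F₁)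
    (hF₂ : Literature.MathematicalPhysics.QuantumLattice.IsLocalObservable F₂)
    (hc₁ : Continuous F₁) (hc₂ : Continuous F₂) (hb₁ : ∃ C, ∀ U, |F₁ U| ≤ C) (hb₂ : ∃ C, ∀ U, |F₂ U| ≤ C) :
    ∃ C : ℝ, ∀ x : (Literature.Probability.LatticeModels.Site 2), ∀ᶠ L : ℕ in atTop,
      |wilsonExpectation (L := L + 1) ρ β
            (toTorusObservable (L + 1) fun U => F₁ U * F₂ (configShift x U)) -
          wilsonExpectation (L := L + 1) ρ β (toTorusObservable (L + 1) F₁) *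
            wilsonExpectation (L := L + 1) ρ β (toTorusObservable (L + 1) (F₂ ∘ configShift x))| ≤
        C * Real.exp (-m * ‖x‖) := by
  obtain ⟨S₁, hS₁⟩ := hF₁
  obtain ⟨S₂, hS₂⟩ := hF₂
  obtain ⟨C₁, hC₁⟩ := hb₁
  obtain ⟨C₂, hC₂⟩ := hb₂
  obtain ⟨a₁, b₁, R₁, T₁, hbox₁⟩ := exists_zbox_of_finset S₁
  obtain ⟨a₂, b₂, R₂, T₂, hbox₂⟩ := exists_zbox_of_finset S₂
  exact torusClustering_two ρ hρ β hm hS₁ hS₂ hc₁ hc₂ hC₁ hC₂ hbox₁ hbox₂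

end Clustering

end Summit.Ventures.LatticeQCDFlow.Scoring
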